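import Mathlib
import Literature.Computability.Complexity.CoveringBoundsTermRank
import HarnessLib

/-!
# Rectangle coverings: invariance under redundant rows/columns and the Boolean-lattice embedding
# (Fiorini–Kaibel–Pashkovich–Theis 2013, Lemma 9 and Lemma 11) — PROVED

Source: S. Fiorini, V. Kaibel, K. Pashkovich, D. O. Theis, *Combinatorial bounds on nonnegative rank and
extended formulations*, Discrete Math. 313 (2013) 67–83 = arXiv:1111.0444
[FioriniKaibelPashkovichTheis2013] (held text `paper:arxiv-1111.0444`), §2.4–§2.5 (held text pp. 7–8).
Verbatim: "A rectangle is a set of the form `I × J` … A rectangle covering of `M` is a set of rectangles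
whose union equals `supp(M)`. … The rectangle covering number of `M` is the smallest cardinality
`rc(M)` of any rectangle covering of `M`. … Clearly, adding a row or a column to a nonnegative matrix
does neither decrease the rectangle covering number nor the nonnegative rank. The following result on
the rectangle covering number is easy to see. **Lemma 9.** The rectangle covering number remains
unchanged if one adds a row or a column whose support is the union of the supports of some existing
rows or columns, respectively." (p. 7) "we can regard a rectangle covering of a Boolean (or 0/1-)
matrix `M` with `r` rectangles as a rank-`r` Boolean factorization, that is a factorization `M = TU`
expressing `M` as the Boolean product of two Boolean matrices `T` with `r` columns and `U` with `r`
rows. Furthermore, a rank-`r` Boolean factorization of a Boolean matrix `M` is equivalent to an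
embedding of the relation defined by `M` into the Boolean lattice `2^[r]` …, in the sense of the
following lemma. **Lemma 11.** Let `M` be a `m × n` Boolean matrix. Then `M` admits a rank-`r` Boolean
factorization `M = TU` if and only if there are functions `f : [m] → 2^[r]` and `g : [n] → 2^[r]` such
that `M_{ij} = 0` if and only if `g(j) ⊆ f(i)` for all `(i,j) ∈ [m] × [n]`. Proof. This follows
immediately by interpreting the `i`th row of the left factor `T` as the incidence vector of the
complement of the set `f(i)` and the `j`th column of the right factor `U` as the incidence vector of the
set `g(j)`." (p. 8)

## What is proved (tree vocabulary: a rank-`r` Boolean factorization / rectangle covering with `r`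
## rectangles of the Boolean matrix `M : X → Y → Bool` is `IsOneCover M R C`, `R : Fin r → X → Bool`,
## `C : Fin r → Y → Bool`, of `CoveringBoundsTermRank.lean`; no optimum `rc` is defined — witness form)

* **Lemma 9** — rows: `IsOneCover.restrictRows` (deleting rows keeps a covering), `IsOneCover.extendRows`
  (a covering of `M` extends to a matrix `M'` each of whose rows has support a union of supports of rows
  of `M`), `FKPT2013_lemma9_rows` (so coverings with `r` rectangles exist for `M'` iff for `M`); columns:
  `IsOneCover.swap` (transposition) and `FKPT2013_lemma9_cols`;
* **Lemma 11** `FKPT2013_lemma11` : `M` has a covering by `r` rectangles iff there are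
  `f : X → 2^[r]`, `g : Y → 2^[r]` with `M_{ij} = 0 ↔ g(j) ⊆ f(i)`.

Honest framing: Literature infrastructure (rectangle coverings / extended formulations); nothing here
bears on `P ≠ NP`.
-/

namespace Literature.Computability.Complexity

open Finset

variable {X X' Y Y' : Type*}

/-! ### Lemma 9: redundant rows and columns -/

/-- Deleting (or pulling back) rows keeps a rectangle covering: if the rows of `M` are rows of `M'`
(`M' (e i) = M i`), a covering of `M'` restricts to one of `M` ("adding a row … does [not] decrease the
rectangle covering number"). [cite: FioriniKaibelPashkovichTheis2013, §2.4 before Lemma 9 (held text p. 7)] -/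
theorem IsOneCover.restrictRows {M : X → Y → Bool} {M' : X' → Y → Bool} (e : X → X')
    (he : ∀ i j, M' (e i) j = M i j) {r : ℕ} {R : Fin r → X' → Bool} {C : Fin r → Y → Bool}
    (h : IsOneCover M' R C) : IsOneCover M (fun k i => R k (e i)) C :=
  ⟨fun k i j hR hC => by rw [← he]; exact h.1 k (e i) j hR hC,
    fun i j hij => h.2 (e i) j (by rw [he]; exact hij)⟩

/-- **FKPT Lemma 9, the extension step (rows)**: if every row `x'` of `M'` has support equal to the
union of the supports of the rows `i ∈ I(x')` of `M`, then a covering of `M` by `r` rectangles extends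
to one of `M'` (put `x'` into the `k`th rectangle iff some `i ∈ I(x')` is in it).
[cite: FioriniKaibelPashkovichTheis2013, Lemma 9 (held text p. 7)] -/
theorem IsOneCover.extendRows [DecidableEq X] {M : X → Y → Bool} {M' : X' → Y → Bool}
    (I : X' → Finset X) (hI : ∀ x' j, M' x' j = true ↔ ∃ i ∈ I x', M i j = true)
    {r : ℕ} {R : Fin r → X → Bool} {C : Fin r → Y → Bool} (h : IsOneCover M R C) :
    IsOneCover M' (fun k x' => decide (∃ i ∈ I x', R k i = true)) C := by
  refine ⟨fun k x' j hR hC => ?_, fun x' j hx' => ?_⟩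
  · obtain ⟨i, hi, hRi⟩ := of_decide_eq_true hR
    exact (hI x' j).2 ⟨i, hi, h.1 k i j hRi hC⟩
  · obtain ⟨i, hi, hMi⟩ := (hI x' j).1 hx'
    obtain ⟨k, hRk, hCk⟩ := h.2 i j hMi
    exact ⟨k, decide_eq_true ⟨i, hi, hRk⟩, hCk⟩

/-- **FKPT Lemma 9 (rows).** If the rows of `M` sit inside `M'` (`M' (e i) = M i`) and every row of
`M'` has support a union of supports of rows of `M`, then `M'` has a covering by `r` rectangles iff `M`
does: "the rectangle covering number remains unchanged if one adds a row … whose support is the union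
of the supports of some existing rows". [cite: FioriniKaibelPashkovichTheis2013, Lemma 9 (held text p. 7)] -/
theorem FKPT2013_lemma9_rows [DecidableEq X] {M : X → Y → Bool} {M' : X' → Y → Bool} (e : X → X')
    (he : ∀ i j, M' (e i) j = M i j) (I : X' → Finset X)
    (hI : ∀ x' j, M' x' j = true ↔ ∃ i ∈ I x', M i j = true) (r : ℕ) :
    (∃ (R : Fin r → X' → Bool) (C : Fin r → Y → Bool), IsOneCover M' R C) ↔
      ∃ (R : Fin r → X → Bool) (C : Fin r → Y → Bool), IsOneCover M R C :=
  ⟨fun ⟨_, C, h⟩ => ⟨_, C, h.restrictRows e he⟩, fun ⟨_, C, h⟩ => ⟨_, C, h.extendRows I hI⟩⟩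

/-- Transposition: a covering of `M` is a covering of `Mᵀ` with the roles of `R` and `C` exchanged.
[cite: FioriniKaibelPashkovichTheis2013, Lemma 9 ("a row or a column … respectively", held text p. 7)] -/
theorem IsOneCover.swap {M : X → Y → Bool} {r : ℕ} {R : Fin r → X → Bool} {C : Fin r → Y → Bool}
    (h : IsOneCover M R C) : IsOneCover (fun y x => M x y) C R :=
  ⟨fun k y x hC hR => h.1 k x y hR hC, fun y x hyx => by
    obtain ⟨k, hR, hC⟩ := h.2 x y hyx
    exact ⟨k, hC, hR⟩⟩

/-- `IsOneCover` is invariant under transposition. [cite: FioriniKaibelPashkovichTheis2013, §2.4 (held text p. 7)] -/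
theorem isOneCover_swap_iff {M : X → Y → Bool} {r : ℕ} {R : Fin r → X → Bool} {C : Fin r → Y → Bool} :
    IsOneCover (fun y x => M x y) C R ↔ IsOneCover M R C :=
  ⟨fun h => h.swap, fun h => h.swap⟩

/-- **FKPT Lemma 9 (columns).** If the columns of `M` sit inside `M'` (`M' i (e j) = M i j`) and every
column of `M'` has support a union of supports of columns of `M`, then `M'` has a covering by `r`
rectangles iff `M` does. [cite: FioriniKaibelPashkovichTheis2013, Lemma 9 (held text p. 7)] -/
theorem FKPT2013_lemma9_cols [DecidableEq Y] {M : X → Y → Bool} {M' : X → Y' → Bool} (e : Y → Y')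
    (he : ∀ i j, M' i (e j) = M i j) (J : Y' → Finset Y)
    (hJ : ∀ i y', M' i y' = true ↔ ∃ j ∈ J y', M i j = true) (r : ℕ) :
    (∃ (R : Fin r → X → Bool) (C : Fin r → Y' → Bool), IsOneCover M' R C) ↔
      ∃ (R : Fin r → X → Bool) (C : Fin r → Y → Bool), IsOneCover M R C := by
  have h := FKPT2013_lemma9_rows (M := fun y x => M x y) (M' := fun y' x => M' x y') e
    (fun j i => he i j) J (fun y' i => hJ i y') r
  constructor
  · rintro ⟨R, C, hc⟩
    obtain ⟨R₁, C₁, h₁⟩ := h.1 ⟨C, R, hc.swap⟩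
    exact ⟨C₁, R₁, h₁.swap⟩
  · rintro ⟨R, C, hc⟩
    obtain ⟨R₁, C₁, h₁⟩ := h.2 ⟨C, R, hc.swap⟩
    exact ⟨C₁, R₁, h₁.swap⟩

/-! ### Lemma 11: Boolean factorizations as embeddings into `2^[r]` -/

/-- **FKPT Lemma 11.** A Boolean matrix `M` admits a rank-`r` Boolean factorization (a covering of its
`1`s by `r` rectangles) iff there are `f : X → 2^[r]` and `g : Y → 2^[r]` with `M_{ij} = 0 ↔ g(j) ⊆ f(i)`
("interpreting the `i`th row of the left factor `T` as the incidence vector of the complement of the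
set `f(i)` and the `j`th column of the right factor `U` as the incidence vector of the set `g(j)`").
[cite: FioriniKaibelPashkovichTheis2013, Lemma 11 (held text p. 8)] -/
theorem FKPT2013_lemma11 (M : X → Y → Bool) (r : ℕ) :
    (∃ (R : Fin r → X → Bool) (C : Fin r → Y → Bool), IsOneCover M R C) ↔
      ∃ (f : X → Finset (Fin r)) (g : Y → Finset (Fin r)), ∀ i j, M i j = false ↔ g j ⊆ f i := by
  classical
  constructor
  · rintro ⟨R, C, hone, hcov⟩
    refine ⟨fun i => univ.filter fun k => R k i = false, fun j => univ.filter fun k => C k j = true,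
      fun i j => ⟨fun hij k hk => ?_, fun hsub => ?_⟩⟩
    · -- `M_{ij} = 0`: no rectangle through column `j` contains row `i`
      have hCk := (Finset.mem_filter.1 hk).2
      refine Finset.mem_filter.2 ⟨mem_univ _, ?_⟩
      rcases hRk : R k i with _ | _
      · rfl
      · have := hone k i j hRk hCk
        rw [hij] at this
        exact absurd this Bool.false_ne_true
    · -- `g(j) ⊆ f(i)`: a `1` at `(i,j)` would be covered by some `k ∈ g(j) \ f(i)`
      rcases hij : M i j with _ | _
      · rfl
      · obtain ⟨k, hRk, hCk⟩ := hcov i j hij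
        have hk := hsub (Finset.mem_filter.2 ⟨mem_univ _, hCk⟩)
        have := (Finset.mem_filter.1 hk).2
        rw [hRk] at this
        exact absurd this.symm Bool.false_ne_true
  · rintro ⟨f, g, hfg⟩
    refine ⟨fun k i => decide (k ∉ f i), fun k j => decide (k ∈ g j), fun k i j hR hC => ?_,
      fun i j hij => ?_⟩
    · -- the rectangles are all-`1`: `k ∈ g(j) \ f(i)` forbids `g(j) ⊆ f(i)`
      have hR' := of_decide_eq_true hR
      have hC' := of_decide_eq_true hC
      rcases hM : M i j with _ | _
      · exact absurd ((hfg i j).1 hM hC') hR'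
      · rfl
    · -- a `1` at `(i,j)`: `g(j) ⊄ f(i)`, pick `k ∈ g(j) \ f(i)`
      have hns : ¬ g j ⊆ f i := fun hs => by
        have := (hfg i j).2 hs
        rw [hij] at this
        exact Bool.noConfusion this
      obtain ⟨k, hkg, hkf⟩ := Finset.not_subset.1 hns
      exact ⟨k, decide_eq_true hkf, decide_eq_true hkg⟩

end Literature.Computability.Complexity
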